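import Summits.ValiantsHypothesis.ValiantsHypothesis.Theorems.GrenetZeonDualUnipotentThreeHalvesHeavyTopTowerEmbedding
import Summits.ValiantsHypothesis.ValiantsHypothesis.Theorems.GrenetZeonDualUnipotentThreeHalvesHeavyTopTowerBase

/-!
# `GrenetZeon.DualUnipotentThreeHalves` (stmt-ValiantsHypothesis-24318), R2 heavy-top instrument — TOWERS HAVE FULL NILINDEX:
# `T(p, I, q)` contains an element `B` with `B ^ (p + q + 2) ≠ 0`

Experiment cell «val-heavytop-census» (D-0160), engine seat val-htc-eng-2 g6 (MAINTENANCE chore (i) of director R524-htc: the NILINDEX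
COROLLARY of COROLLARY II, lead EXTREMISERS X16 reading R-d1).  First of two files.

For the tower hull `T(p, I, q) = towerHull p q I ≤ M_{p+3+q}(ℂ)` (✓ `…HeavyTopTowerDefs`) and ANY `N ∈ I` with `N * N ≠ 0` (such an `N` exists in
every irreducible nilpotent plane `I ≤ M₃(ℂ)`: ✓ `exists_sq_ne_zero_of_irreducible`), the tower contains a matrix `B` with `B ^ (p + q + 2) ≠ 0`,
i.e. of nilindex `p + q + 3 = m` (the maximum for a nilpotent `m × m` matrix).  Consequently a codimension-one nilpotent space in TOWER FORM
(second branch of ✓ `codimOne_classification`) always contains an element `A` with `A ^ (m - 1) ≠ 0` (`exists_pow_ne_zero_of_tower_form`), so the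
spaces of nilindex `≤ m − 1` and dimension `C(m,2) − 1` all fall into the triangularisable branch — the input of the sibling file
`…HeavyTopNilIndexCodimOne` (hyperplanes of `𝔫_m` of nilindex `< m` are the coordinate hyperplanes `𝔫_m ∖ {E_{i,i+1}}`).

Proof: bordering.  Start from `N` itself (`T(0, I, 0) = I`, ✓ `mem_towerHull_zero_zero`); a matrix `B` with `B ^ k ≠ 0` is bordered by ONE
column `X` with `B ^ k X ≠ 0` (resp. one row `X` with `X B ^ k ≠ 0`), and `[[B, X], [0, 0]] ^ (k+1) = [[B ^ (k+1), B ^ k X], [0, 0]] ≠ 0`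
(resp. `[[0, X], [0, B]] ^ (k+1) = [[0, X B ^ k], [0, B ^ (k+1)]]`); the bordered matrix lies in `T(p, I, q+1)` (resp. `T(1+p, I, q)`) by the
re-embedding lemmas ✓ R / L of `…HeavyTopTowerEmbedding`.

* `fromBlocks_pow_succ_of_bot_zero`, `fromBlocks_pow_succ_of_top_zero` — powers of one-sided borderings;
* `exists_mem_towerHull_zero_zero_sq_ne_zero`, `exists_mem_towerHull_succ_right`, `exists_mem_towerHull_succ_left` — base and bordering steps;
* ★ `towerHull_exists_pow_ne_zero` — the statement; `conj_pow` (bookkeeping) and ★ `exists_pow_ne_zero_of_tower_form` — the tower branch of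
  COROLLARY II has nilindex `m`.

Honest framing: enemy-side structure for the census instrument (EXTREMISERS X16 R-d1); nothing here proves or refutes `HeavyTopLaw`, 24318, S3b or 8062;
`VP ≠ VNP` is NOT proved.  No definitions, no named facts.  [folklore linear algebra over val-idea-30 MEMO codim-one COROLLARY II; this cell]
-/

noncomputable section

-- single-conjunct layout: Sub = Summit, duplicated namespace component intended
set_option linter.dupNamespace false

namespace Summit.ValiantsHypothesis.ValiantsHypothesis.Theorems.GrenetZeon.HeavyTopNilIndexTower

open Matrix
open Summit.ValiantsHypothesis.ValiantsHypothesis.Theorems.GrenetZeon.HeavyTopTowerDefs (towerHull)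
open Summit.ValiantsHypothesis.ValiantsHypothesis.Theorems.GrenetZeon.HeavyTopTowerEmbedding (reindex_fromBlocks_mem_towerHull_iff
  reindex_fromBlocks_mem_towerHull_iff_left)
open Summit.ValiantsHypothesis.ValiantsHypothesis.Theorems.GrenetZeon.HeavyTopTowerBase (mem_towerHull_zero_zero midBlock_zero_zero_reindex)
open Literature.LinearAlgebra.Matrix (IsStrictUpper isStrictUpper_zero)

/-! ## Powers of one-sided borderings -/

/-- `[[T, X], [0, 0]] ^ (j+1) = [[T ^ (j+1), T ^ j X], [0, 0]]`. [folklore] -/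
theorem fromBlocks_pow_succ_of_bot_zero {n d : Type*} [Fintype n] [Fintype d] [DecidableEq n] [DecidableEq d]
    (T : Matrix n n ℂ) (X : Matrix n d ℂ) (j : ℕ) :
    (Matrix.fromBlocks T X 0 (0 : Matrix d d ℂ)) ^ (j + 1) = Matrix.fromBlocks (T ^ (j + 1)) (T ^ j * X) 0 0 := by
  induction j with
  | zero => rw [zero_add, pow_one, pow_one, pow_zero, Matrix.one_mul]
  | succ j ih =>
    rw [pow_succ, ih, Matrix.fromBlocks_multiply]
    simp only [Matrix.mul_zero, Matrix.zero_mul, add_zero, ← pow_succ]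

/-- `[[0, X], [0, T]] ^ (j+1) = [[0, X T ^ j], [0, T ^ (j+1)]]`. [folklore] -/
theorem fromBlocks_pow_succ_of_top_zero {c n : Type*} [Fintype c] [Fintype n] [DecidableEq c] [DecidableEq n]
    (X : Matrix c n ℂ) (T : Matrix n n ℂ) (j : ℕ) :
    (Matrix.fromBlocks (0 : Matrix c c ℂ) X 0 T) ^ (j + 1) = Matrix.fromBlocks 0 (X * T ^ j) 0 (T ^ (j + 1)) := by
  induction j with
  | zero => rw [zero_add, pow_one, pow_one, pow_zero, Matrix.mul_one]
  | succ j ih =>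
    rw [pow_succ, ih, Matrix.fromBlocks_multiply]
    simp only [Matrix.mul_zero, Matrix.zero_mul, zero_add, Matrix.mul_assoc, ← pow_succ]

/-! ## Base and bordering steps -/

/-- Base `p = q = 0`: `N ∈ I` with `N * N ≠ 0` is (re-indexed) a member of `T(0, I, 0)` with non-zero square. [this file] -/
theorem exists_mem_towerHull_zero_zero_sq_ne_zero (I : Submodule ℂ (Matrix (Fin 3) (Fin 3) ℂ)) {N : Matrix (Fin 3) (Fin 3) ℂ}
    (hN : N ∈ I) (hN2 : N * N ≠ 0) : ∃ B ∈ towerHull 0 0 I, B ^ 2 ≠ 0 := by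
  have h : 3 = 0 + 3 + 0 := by norm_num
  refine ⟨Matrix.reindex (finCongr h) (finCongr h) N, ?_, ?_⟩
  · rw [mem_towerHull_zero_zero, midBlock_zero_zero_reindex]; exact hN
  · intro h0
    have h1 : Matrix.reindexAlgEquiv ℂ ℂ (finCongr h) (N ^ 2) = 0 := by rw [map_pow]; exact h0
    rw [map_eq_zero_iff _ (Matrix.reindexAlgEquiv ℂ ℂ _).injective, pow_two] at h1
    exact hN2 h1

/-- A non-zero matrix has a non-zero entry. -/
theorem exists_apply_ne_zero {n : Type*} {M : Matrix n n ℂ} (hM : M ≠ 0) : ∃ i j, M i j ≠ 0 := by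
  by_contra h
  push Not at h
  exact hM (Matrix.ext fun i j => h i j)

/-- Bordering on the RIGHT: from `B ∈ T(p, I, q)` with `B ^ k ≠ 0` to a member of `T(p, I, q+1)` with `(·) ^ (k+1) ≠ 0`. [this file] -/
theorem exists_mem_towerHull_succ_right {p q : ℕ} (I : Submodule ℂ (Matrix (Fin 3) (Fin 3) ℂ))
    {B : Matrix (Fin (p + 3 + q)) (Fin (p + 3 + q)) ℂ} (hB : B ∈ towerHull p q I) {k : ℕ} (hk : B ^ k ≠ 0) :
    ∃ B' ∈ towerHull p (q + 1) I, B' ^ (k + 1) ≠ 0 := by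
  classical
  obtain ⟨i, j, hij⟩ := exists_apply_ne_zero hk
  -- the bordering column `X = e_j`
  set X : Matrix (Fin (p + 3 + q)) (Fin 1) ℂ := Matrix.of fun l _ => if l = j then (1 : ℂ) else 0 with hX
  have hBX : B ^ k * X ≠ 0 := by
    intro h0
    have h1 := congrFun (congrFun h0 i) 0
    rw [Matrix.mul_apply, Finset.sum_eq_single j, hX, Matrix.of_apply, if_pos rfl, mul_one, Matrix.zero_apply] at h1
    · exact hij h1
    · intro l _ hl; rw [hX, Matrix.of_apply, if_neg hl, mul_zero]
    · intro h; exact absurd (Finset.mem_univ j) h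
  refine ⟨Matrix.reindex (finSumFinEquiv.trans (finCongr (Nat.add_assoc (p + 3) q 1)))
      (finSumFinEquiv.trans (finCongr (Nat.add_assoc (p + 3) q 1))) (Matrix.fromBlocks B X 0 (0 : Matrix (Fin 1) (Fin 1) ℂ)), ?_, ?_⟩
  · exact (reindex_fromBlocks_mem_towerHull_iff I B X 0 0).2 ⟨hB, rfl, isStrictUpper_zero⟩
  · intro h0
    have h1 : Matrix.reindexAlgEquiv ℂ ℂ (finSumFinEquiv.trans (finCongr (Nat.add_assoc (p + 3) q 1)))
        ((Matrix.fromBlocks B X 0 (0 : Matrix (Fin 1) (Fin 1) ℂ)) ^ (k + 1)) = 0 := by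
      rw [map_pow]; exact h0
    rw [map_eq_zero_iff _ (Matrix.reindexAlgEquiv ℂ ℂ _).injective, fromBlocks_pow_succ_of_bot_zero, ← Matrix.fromBlocks_zero,
      Matrix.fromBlocks_inj] at h1
    exact hBX h1.2.1

/-- Bordering on the LEFT: from `B ∈ T(p, I, q)` with `B ^ k ≠ 0` to a member of `T(1+p, I, q)` with `(·) ^ (k+1) ≠ 0`. [this file] -/
theorem exists_mem_towerHull_succ_left {p q : ℕ} (I : Submodule ℂ (Matrix (Fin 3) (Fin 3) ℂ))
    {B : Matrix (Fin (p + 3 + q)) (Fin (p + 3 + q)) ℂ} (hB : B ∈ towerHull p q I) {k : ℕ} (hk : B ^ k ≠ 0) :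
    ∃ B' ∈ towerHull (1 + p) q I, B' ^ (k + 1) ≠ 0 := by
  classical
  obtain ⟨i, j, hij⟩ := exists_apply_ne_zero hk
  -- the bordering row `X = e_iᵀ`
  set X : Matrix (Fin 1) (Fin (p + 3 + q)) ℂ := Matrix.of fun _ l => if l = i then (1 : ℂ) else 0 with hX
  have hXB : X * B ^ k ≠ 0 := by
    intro h0
    have h1 := congrFun (congrFun h0 0) j
    rw [Matrix.mul_apply, Finset.sum_eq_single i, hX, Matrix.of_apply, if_pos rfl, one_mul, Matrix.zero_apply] at h1
    · exact hij h1
    · intro l _ hl; rw [hX, Matrix.of_apply, if_neg hl, zero_mul]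
    · intro h; exact absurd (Finset.mem_univ i) h
  have h : 1 + (p + 3 + q) = 1 + p + 3 + q := by omega
  refine ⟨Matrix.reindex (finSumFinEquiv.trans (finCongr h)) (finSumFinEquiv.trans (finCongr h))
      (Matrix.fromBlocks (0 : Matrix (Fin 1) (Fin 1) ℂ) X 0 B), ?_, ?_⟩
  · exact (reindex_fromBlocks_mem_towerHull_iff_left h I 0 X 0 B).2 ⟨isStrictUpper_zero, rfl, hB⟩
  · intro h0
    have h1 : Matrix.reindexAlgEquiv ℂ ℂ (finSumFinEquiv.trans (finCongr h))
        ((Matrix.fromBlocks (0 : Matrix (Fin 1) (Fin 1) ℂ) X 0 B) ^ (k + 1)) = 0 := by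
      rw [map_pow]; exact h0
    rw [map_eq_zero_iff _ (Matrix.reindexAlgEquiv ℂ ℂ _).injective, fromBlocks_pow_succ_of_top_zero, ← Matrix.fromBlocks_zero,
      Matrix.fromBlocks_inj] at h1
    exact hXB h1.2.1

/-! ## ★ Towers have full nilindex -/

/-- ★ **`T(p, I, q)` contains an element of nilindex `p + q + 3`** whenever `I ∋ N` with `N * N ≠ 0` (in particular for every irreducible
nilpotent plane `I ≤ M₃(ℂ)`, ✓ `exists_sq_ne_zero_of_irreducible`). [folklore bordering; this file] -/
theorem towerHull_exists_pow_ne_zero (p q : ℕ) (I : Submodule ℂ (Matrix (Fin 3) (Fin 3) ℂ)) {N : Matrix (Fin 3) (Fin 3) ℂ}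
    (hN : N ∈ I) (hN2 : N * N ≠ 0) : ∃ B ∈ towerHull p q I, B ^ (p + q + 2) ≠ 0 := by
  induction q with
  | zero =>
    induction p with
    | zero =>
      obtain ⟨B, hB, h2⟩ := exists_mem_towerHull_zero_zero_sq_ne_zero I hN hN2
      exact ⟨B, hB, by rw [show 0 + 0 + 2 = 2 by norm_num]; exact h2⟩
    | succ p ih =>
      obtain ⟨B, hB, hk⟩ := ih
      obtain ⟨B', hB', hk'⟩ := exists_mem_towerHull_succ_left I hB hk
      rw [Nat.add_comm p 1]
      exact ⟨B', hB', by rw [show 1 + p + 0 + 2 = p + 0 + 2 + 1 by omega]; exact hk'⟩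
  | succ q ih =>
    obtain ⟨B, hB, hk⟩ := ih
    obtain ⟨B', hB', hk'⟩ := exists_mem_towerHull_succ_right I hB hk
    exact ⟨B', hB', by rw [show p + (q + 1) + 2 = p + q + 2 + 1 by omega]; exact hk'⟩

/-! ## The tower branch of COROLLARY II has nilindex `m` -/

/-- `(P A P⁻¹) ^ k = P A ^ k P⁻¹` for `P` with invertible determinant. [folklore] -/
theorem conj_pow {m : ℕ} (P : Matrix (Fin m) (Fin m) ℂ) (hP : IsUnit P.det) (A : Matrix (Fin m) (Fin m) ℂ) (k : ℕ) :
    (P * A * P⁻¹) ^ k = P * A ^ k * P⁻¹ := by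
  induction k with
  | zero => rw [pow_zero, pow_zero, Matrix.mul_one, Matrix.mul_nonsing_inv _ hP]
  | succ k ih =>
    rw [pow_succ, ih, pow_succ, Matrix.mul_assoc (P * A ^ k) P⁻¹, ← Matrix.mul_assoc P⁻¹, ← Matrix.mul_assoc P⁻¹,
      Matrix.nonsing_inv_mul _ hP, Matrix.one_mul, ← Matrix.mul_assoc, ← Matrix.mul_assoc]

/-- ★ **A space in tower form contains an element of nilindex `m`.**  If `A ∈ V ↔ reindex e e (P A P⁻¹) ∈ T(p, I, q)` for a unit `P`, a
re-indexing `e : Fin m ≃ Fin (p+3+q)` and some `I ∋ N` with `N * N ≠ 0`, then some `A ∈ V` has `A ^ (m - 1) ≠ 0`.  (With ✓ `codimOne_classification`: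
codimension-one nilpotent spaces of nilindex `≤ m − 1` are triangularisable.) [this file] -/
theorem exists_pow_ne_zero_of_tower_form {m p q : ℕ} (e : Fin m ≃ Fin (p + 3 + q)) (I : Submodule ℂ (Matrix (Fin 3) (Fin 3) ℂ))
    {N : Matrix (Fin 3) (Fin 3) ℂ} (hN : N ∈ I) (hN2 : N * N ≠ 0)
    (P : Matrix (Fin m) (Fin m) ℂ) (hP : IsUnit P) (V : Submodule ℂ (Matrix (Fin m) (Fin m) ℂ))
    (hV : ∀ A, A ∈ V ↔ Matrix.reindex e e (P * A * P⁻¹) ∈ towerHull p q I) :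
    ∃ A ∈ V, A ^ (m - 1) ≠ 0 := by
  classical
  have hPdet : IsUnit P.det := (Matrix.isUnit_iff_isUnit_det P).1 hP
  have hm : m = p + 3 + q := by simpa using Fintype.card_congr e
  obtain ⟨B, hB, hBk⟩ := towerHull_exists_pow_ne_zero p q I hN hN2
  -- pull `B` back along `A ↦ reindex e e (P A P⁻¹)`
  refine ⟨P⁻¹ * Matrix.reindex e.symm e.symm B * P, ?_, ?_⟩
  · rw [hV, Matrix.mul_assoc P⁻¹, Matrix.mul_nonsing_inv_cancel_left _ _ hPdet, Matrix.mul_nonsing_inv_cancel_right _ _ hPdet]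
    have : Matrix.reindex e e (Matrix.reindex e.symm e.symm B) = B := by
      ext i j; simp [Matrix.reindex_apply]
    rw [this]; exact hB
  · intro h0
    have h1 : P * (P⁻¹ * Matrix.reindex e.symm e.symm B * P) ^ (m - 1) * P⁻¹ = 0 := by rw [h0, Matrix.mul_zero, Matrix.zero_mul]
    rw [← conj_pow P hPdet, Matrix.mul_assoc P⁻¹, Matrix.mul_nonsing_inv_cancel_left _ _ hPdet,
      Matrix.mul_nonsing_inv_cancel_right _ _ hPdet] at h1
    have h2 : Matrix.reindexAlgEquiv ℂ ℂ e.symm (B ^ (m - 1)) = 0 := by rw [map_pow]; exact h1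
    rw [map_eq_zero_iff _ (Matrix.reindexAlgEquiv ℂ ℂ _).injective, show m - 1 = p + q + 2 by omega] at h2
    exact hBk h2

end Summit.ValiantsHypothesis.ValiantsHypothesis.Theorems.GrenetZeon.HeavyTopNilIndexTower

end
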